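import Literature.NumberTheory.LFunctions.Zhang2022.Section8Defs

/-!
# Zhang (2022) §8: exact evaluation of the integrals `b₁₁, b₂₂, b₂₁, b₁₂`

Trunk T-ANT (NumberTheory/LFunctions). Companion of `Section8Defs.lean` (Y. Zhang,
arXiv:2211.02515v1, §8, (8.13)–(8.22) [Zhang2022LandauSiegel]; an unrefereed manuscript under
adjudication — this file only does calculus on the printed definitions).

Every integrand in (8.19)–(8.22) is, after expanding the products
`𝔣𝔣(z)𝔤𝔥(z)`, `𝔣𝔣(z)𝔤𝔥(z+s)`, `𝔣𝔣(z+s)𝔤𝔥(z)` (`ffF_mul_ghF`, `ffF_mul_ghF_shiftR`,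
`ffF_shift_mul_ghF`), a sum of terms `(q₀ + q₁z + q₂z²)e^{mπiz}` with rational `m`
(`m = 0` allowed). These have the elementary antiderivatives
`P(z)e^{mπiz}`, `P = P₀ + P₁z + P₂z²` with `u = 1/(mπ)` and
`P₀ = −iq₀u + q₁u² + 2iq₂u³`, `P₁ = −iq₁u + 2q₂u²`, `P₂ = −iq₂u` (`integral_quad_mul_cexp`,
proved by the fundamental theorem of calculus from an explicit `HasDerivAt`), resp.
`q₀L + q₁L²/2 + q₂L³/3` (`integral_quad`). The results are the closed forms `b11_eq`, `b22_eq`,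
`b21_eq`, `b12_eq` expressing the four printed integrals through `expQuadInt`/`polyInt`; the only
transcendental quantities left are `π` and `e^{θπi}` at rational `θ`, which
`Section8Certificate.lean` encloses rigorously.

Design: all closed forms are written in a shape that the interval engine of
`Literature.Analysis.ValidatedNumerics` mirrors operation by operation (real factors on the
right as coercions `((x : ℝ) : ℂ)`, `u = (m⁻¹ : ℚ)/π` as `overPi m⁻¹`, the integer `2` as
`((2 : ℤ) : ℂ)`); this is why some expressions look slightly unidiomatic.
-/

noncomputable section

open Complex Real intervalIntegral ComplexConjugate

namespace Literature.NumberTheory.LFunctions.Zhang2022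

/-! ### Pointwise expansions of the integrands -/

/-- `𝔣𝔣_{a,k}(z)·𝔤𝔥_{r₀,r₁,b,k}(z) = (r₀ + r₀aπi z)e^{kπiz} + (r₁ + (ar₁+b)πi z + ab(πi)² z²)`
(same frequency: the exponentials cancel in the second product). [folklore] -/
theorem ffF_mul_ghF (a k r0 r1 b : ℚ) (z : ℝ) :
    ffF a k z * ghF r0 r1 b k z
      = ((r0 : ℂ) + (r0 * a * π * I) * z + 0 * (z * z)) * cexp (k * π * I * z)
        + ((r1 : ℂ) + ((a * r1 + b) * π * I) * z + (a * b * (π * I) ^ 2) * (z * z)) := by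
  unfold ffF ghF
  have h : cexp (k * π * I * z) * cexp (-(k * π * I * z)) = 1 := by
    rw [← Complex.exp_add, add_neg_cancel, Complex.exp_zero]
  linear_combination ((1 : ℂ) + a * π * I * z) * (r1 + b * π * I * z) * h

/-- Cross term of type (8.21): `𝔣𝔣_{a,k}(z)·𝔤𝔥_{r₀,r₁,b,k'}(z+s)
= (r₀ + r₀aπi z)e^{kπiz} + e^{−k'πis}(R + (aR+b)πi z + ab(πi)²z²)e^{(k−k')πiz}`, `R = r₁ + bπis`.
[folklore] -/
theorem ffF_mul_ghF_shiftR (a k r0 r1 b k' : ℚ) (z s : ℝ) :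
    ffF a k z * ghF r0 r1 b k' (z + s)
      = ((r0 : ℂ) + (r0 * a * π * I) * z + 0 * (z * z)) * cexp (k * π * I * z)
        + cexp (-(k' * π * I * s)) *
          ((((r1 : ℂ) + b * π * I * s) + ((a * (r1 + b * π * I * s) + b) * π * I) * z
            + (a * b * (π * I) ^ 2) * (z * z)) * cexp (((k - k' : ℚ) : ℂ) * π * I * z)) := by
  unfold ffF ghF
  push_cast
  have h : cexp (k * π * I * z) * cexp (-(k' * π * I * (z + s)))
      = cexp (-(k' * π * I * s)) * cexp ((k - k') * π * I * z) := by
    rw [← Complex.exp_add, ← Complex.exp_add]; congr 1; ring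
  linear_combination ((1 : ℂ) + a * π * I * z) * (r1 + b * π * I * (z + s)) * h

/-- Cross term of type (8.22): `𝔣𝔣_{a,k}(z+s)·𝔤𝔥_{r₀,r₁,b,k'}(z)
= e^{kπis}[(r₀U + r₀aπi z)e^{kπiz} + (Ur₁ + (Ub+ar₁)πi z + ab(πi)²z²)e^{(k−k')πiz}]`,
`U = 1 + aπis`. [folklore] -/
theorem ffF_shift_mul_ghF (a k r0 r1 b k' : ℚ) (z s : ℝ) :
    ffF a k (z + s) * ghF r0 r1 b k' z
      = cexp (k * π * I * s) *
          ((((r0 : ℂ) * (1 + a * π * I * s) + (r0 * a * π * I) * z + 0 * (z * z))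
              * cexp (k * π * I * z))
          + ((((1 : ℂ) + a * π * I * s) * r1 + (((1 + a * π * I * s) * b + a * r1) * π * I) * z
              + (a * b * (π * I) ^ 2) * (z * z)) * cexp (((k - k' : ℚ) : ℂ) * π * I * z))) := by
  unfold ffF ghF
  push_cast
  have h1 : cexp (k * π * I * (z + s)) = cexp (k * π * I * s) * cexp (k * π * I * z) := by
    rw [← Complex.exp_add]; congr 1; ring
  have h2 : cexp (k * π * I * (z + s)) * cexp (-(k' * π * I * z))
      = cexp (k * π * I * s) * cexp ((k - k') * π * I * z) := by
    rw [← Complex.exp_add, ← Complex.exp_add]; congr 1; ring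
  linear_combination ((r0 : ℂ) * (1 + a * π * I * (z + s))) * h1
    + ((1 : ℂ) + a * π * I * (z + s)) * (r1 + b * π * I * z) * h2

/-! ### Antiderivatives -/

/-- `q/π` for a rational `q` (the shape in which the interval engine divides by `π`). [folklore] -/
def overPi (q : ℚ) : ℝ := (q : ℝ) / π

/-- Constant coefficient `P₀ = −iq₀u + q₁u² + 2iq₂u³` of the antiderivative polynomial of
`(q₀ + q₁z + q₂z²)e^{mπiz}` (`u = 1/(mπ)`). [folklore] -/
def P0 (q0 q1 q2 : ℂ) (u : ℝ) : ℂ :=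
  -(q0 * u * I) + (q1 * ((u * u : ℝ) : ℂ) + q2 * ((u * u * u : ℝ) : ℂ) * I * ((2 : ℤ) : ℂ))

/-- Linear coefficient `P₁ = −iq₁u + 2q₂u²` (see `P0`). [folklore] -/
def P1 (q1 q2 : ℂ) (u : ℝ) : ℂ := -(q1 * u * I) + q2 * ((u * u : ℝ) : ℂ) * ((2 : ℤ) : ℂ)

/-- Quadratic coefficient `P₂ = −iq₂u` (see `P0`). [folklore] -/
def P2 (q2 : ℂ) (u : ℝ) : ℂ := -(q2 * u * I)

/-- The antiderivative polynomial `P(z) = P₀ + P₁z + P₂z²`. [folklore] -/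
def Pz (q0 q1 q2 : ℂ) (u z : ℝ) : ℂ :=
  P0 q0 q1 q2 u + P1 q1 q2 u * z + P2 q2 u * ((z * z : ℝ) : ℂ)

/-- Closed form `P(L)e^{mπiL} − P(0)` of `∫₀ᴸ (q₀ + q₁z + q₂z²)e^{mπiz} dz`, `m ≠ 0`
(`integral_quad_mul_cexp`). [folklore] -/
def expQuadInt (q0 q1 q2 : ℂ) (m : ℚ) (L : ℝ) : ℂ :=
  Pz q0 q1 q2 (overPi m⁻¹) L * cexp ((((m : ℝ) * L * π : ℝ) : ℂ) * I) - P0 q0 q1 q2 (overPi m⁻¹)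

/-- Closed form `q₀L + q₁L²/2 + q₂L³/3` of `∫₀ᴸ (q₀ + q₁z + q₂z²) dz` (`integral_quad`).
[folklore] -/
def polyInt (q0 q1 q2 : ℂ) (L : ℝ) : ℂ :=
  q0 * L + q1 * ((L * L : ℝ) : ℂ) * (((1/2 : ℚ) : ℝ) : ℂ)
    + q2 * ((L * L * L : ℝ) : ℂ) * (((1/3 : ℚ) : ℝ) : ℂ)

/-- `mπ · (m⁻¹/π) = 1`. [folklore] -/
theorem overPi_inv_mul {m : ℚ} (hm : m ≠ 0) : (m : ℂ) * π * (overPi m⁻¹ : ℝ) = 1 := by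
  unfold overPi
  have hπ : (π : ℂ) ≠ 0 := by exact_mod_cast Real.pi_ne_zero
  have hm' : (m : ℂ) ≠ 0 := by exact_mod_cast hm
  push_cast
  field_simp

/-- `∫₀ᴸ (q₀ + q₁z + q₂z²) e^{mπiz} dz = expQuadInt q₀ q₁ q₂ m L` for rational `m ≠ 0`
(fundamental theorem of calculus with the explicit antiderivative `P(z)e^{mπiz}`). [folklore] -/
theorem integral_quad_mul_cexp (q0 q1 q2 : ℂ) {m : ℚ} (hm : m ≠ 0) (L : ℝ) :
    ∫ z in (0:ℝ)..L, (q0 + q1 * z + q2 * (z * z)) * cexp (m * π * I * z)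
      = expQuadInt q0 q1 q2 m L := by
  have hu := overPi_inv_mul hm
  unfold expQuadInt
  revert hu
  generalize overPi m⁻¹ = u
  intro hu
  have hI : I ^ 2 = -1 := Complex.I_sq
  have hderiv : ∀ z : ℝ, HasDerivAt (fun x : ℝ => Pz q0 q1 q2 u x * cexp (m * π * I * x))
      ((q0 + q1 * z + q2 * (z * z)) * cexp (m * π * I * z)) z := by
    intro z
    have h1 : HasDerivAt (fun x : ℝ => (x : ℂ)) 1 z := by
      simpa using (hasDerivAt_id z).ofReal_comp
    have hP : HasDerivAt (fun x : ℝ => Pz q0 q1 q2 u x) (P1 q1 q2 u + P2 q2 u * (2 * z)) z := by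
      have h := (((h1.const_mul (P1 q1 q2 u)).fun_add ((h1.fun_mul h1).const_mul (P2 q2 u))).const_add
        (P0 q0 q1 q2 u))
      have e : (fun x : ℝ => Pz q0 q1 q2 u x)
          = fun x : ℝ => P0 q0 q1 q2 u + (P1 q1 q2 u * (x : ℂ) + P2 q2 u * ((x : ℂ) * (x : ℂ))) := by
        funext x; unfold Pz; push_cast; ring
      rw [e]
      exact h.congr_deriv (by ring)
    have hE : HasDerivAt (fun x : ℝ => cexp (m * π * I * x)) (cexp (m * π * I * z) * (m * π * I)) z :=
      ((h1.const_mul ((m : ℂ) * π * I)).cexp).congr_deriv (by ring)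
    refine (hP.fun_mul hE).congr_deriv ?_
    unfold Pz P0 P1 P2
    push_cast
    linear_combination
      (cexp (m * π * I * z) * ((q0 + I * u * q1 - 2 * u * u * q2) + (q1 + 2 * I * u * q2) * z
          + q2 * (z * z))) * hu
      + (cexp (m * π * I * z) * (-(m * π * u) * q0 + 2 * (m * π) * u * u * u * q2
          + (-(m * π * u) * q1) * z + (-(m * π * u) * q2) * (z * z))) * hI
  have hint : IntervalIntegrable (fun z : ℝ => (q0 + q1 * z + q2 * (z * z)) * cexp (m * π * I * z))
      MeasureTheory.volume 0 L :=
    (Continuous.intervalIntegrable (by fun_prop) _ _)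
  rw [intervalIntegral.integral_eq_sub_of_hasDerivAt (fun z _ => hderiv z) hint]
  have eL : cexp ((m : ℂ) * π * I * (L : ℂ)) = cexp ((((m : ℝ) * L * π : ℝ) : ℂ) * I) := by
    congr 1; push_cast; ring
  rw [eL]
  unfold Pz
  simp only [Complex.ofReal_zero, mul_zero, Complex.exp_zero, mul_one, add_zero]

/-- `∫₀ᴸ (q₀ + q₁z + q₂z²) dz = polyInt q₀ q₁ q₂ L`. [folklore] -/
theorem integral_quad (q0 q1 q2 : ℂ) (L : ℝ) :
    ∫ z in (0:ℝ)..L, (q0 + q1 * z + q2 * (z * z)) = polyInt q0 q1 q2 L := by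
  have hderiv : ∀ z : ℝ, HasDerivAt
      (fun x : ℝ => q0 * (x : ℂ) + q1 * ((x : ℂ) * (x : ℂ)) * (1/2 : ℂ)
        + q2 * ((x : ℂ) * (x : ℂ) * (x : ℂ)) * (1/3 : ℂ))
      (q0 + q1 * z + q2 * (z * z)) z := by
    intro z
    have h1 : HasDerivAt (fun x : ℝ => (x : ℂ)) 1 z := by
      simpa using (hasDerivAt_id z).ofReal_comp
    have h := ((h1.const_mul q0).fun_add (((h1.fun_mul h1).const_mul q1).mul_const (1/2 : ℂ))).fun_add
      ((((h1.fun_mul h1).fun_mul h1).const_mul q2).mul_const (1/3 : ℂ))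
    exact h.congr_deriv (by ring)
  have hint : IntervalIntegrable (fun z : ℝ => (q0 + q1 * z + q2 * (z * z) : ℂ))
      MeasureTheory.volume 0 L :=
    (Continuous.intervalIntegrable (by fun_prop) _ _)
  rw [intervalIntegral.integral_eq_sub_of_hasDerivAt (fun z _ => hderiv z) hint]
  unfold polyInt
  push_cast
  ring

/-! ### The integrals of (8.19)–(8.22) in closed form -/

/-- `𝔣𝔣_{a,k}` is continuous. [folklore] -/
@[fun_prop] theorem continuous_ffF (a k : ℚ) : Continuous (fun z => ffF a k z) := by
  unfold ffF; fun_prop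

/-- `𝔤𝔥_{r₀,r₁,b,k}` is continuous. [folklore] -/
@[fun_prop] theorem continuous_ghF (r0 r1 b k : ℚ) : Continuous (fun z => ghF r0 r1 b k z) := by
  unfold ghF; fun_prop

/-- Closed form of `∫₀ᴸ 𝔣𝔣_{a,k}(z)𝔤𝔥_{r₀,r₁,b,k}(z) dz` (diagonal terms of (8.19), (8.20)).
[folklore] -/
def FGint (a k r0 r1 b : ℚ) (L : ℝ) : ℂ :=
  expQuadInt (r0 : ℂ) ((r0 : ℂ) * a * π * I) 0 k L
    + polyInt (r1 : ℂ) (((a : ℂ) * r1 + b) * π * I) ((a : ℂ) * b * (π * I) ^ 2) L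

/-- `∫₀ᴸ 𝔣𝔣(z)𝔤𝔥(z) dz = FGint …` for `k ≠ 0`. [folklore] -/
theorem integral_ffF_mul_ghF (a k r0 r1 b : ℚ) (hk : k ≠ 0) (L : ℝ) :
    ∫ z in (0:ℝ)..L, ffF a k z * ghF r0 r1 b k z = FGint a k r0 r1 b L := by
  rw [intervalIntegral.integral_congr (fun z _ => ffF_mul_ghF a k r0 r1 b z),
    intervalIntegral.integral_add (Continuous.intervalIntegrable (by fun_prop) _ _)
      (Continuous.intervalIntegrable (by fun_prop) _ _),
    integral_quad_mul_cexp _ _ _ hk, integral_quad]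
  rfl

/-- Closed form of `∫₀ᴸ 𝔣𝔣_{a,k}(z)𝔤𝔥_{r₀,r₁,b,k'}(z+s) dz` (the terms of (8.21)). [folklore] -/
def FGXint (a k r0 r1 b k' : ℚ) (L s : ℝ) : ℂ :=
  expQuadInt (r0 : ℂ) ((r0 : ℂ) * a * π * I) 0 k L
    + cexp ((((-(k' : ℝ)) * s * π : ℝ) : ℂ) * I) *
      expQuadInt ((r1 : ℂ) + b * π * I * s) (((a : ℂ) * (r1 + b * π * I * s) + b) * π * I)
        ((a : ℂ) * b * (π * I) ^ 2) (k - k') L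

/-- `∫₀ᴸ 𝔣𝔣_{a,k}(z)𝔤𝔥_{r₀,r₁,b,k'}(z+s) dz = FGXint …` for `k ≠ 0`, `k ≠ k'`. [folklore] -/
theorem integral_ffF_mul_ghF_shiftR (a k r0 r1 b k' : ℚ) (hk : k ≠ 0) (hkk : k - k' ≠ 0)
    (L s : ℝ) :
    ∫ z in (0:ℝ)..L, ffF a k z * ghF r0 r1 b k' (z + s) = FGXint a k r0 r1 b k' L s := by
  rw [intervalIntegral.integral_congr (fun z _ => ffF_mul_ghF_shiftR a k r0 r1 b k' z s),
    intervalIntegral.integral_add (Continuous.intervalIntegrable (by fun_prop) _ _)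
      (Continuous.intervalIntegrable (by fun_prop) _ _),
    intervalIntegral.integral_const_mul,
    integral_quad_mul_cexp _ _ _ hk, integral_quad_mul_cexp _ _ _ hkk]
  have eS : cexp (-((k' : ℂ) * π * I * (s : ℂ))) = cexp ((((-(k' : ℝ)) * s * π : ℝ) : ℂ) * I) := by
    congr 1; push_cast; ring
  rw [eS]
  rfl

/-- Closed form of `∫₀ᴸ 𝔣𝔣_{a,k}(z+s)𝔤𝔥_{r₀,r₁,b,k'}(z) dz` (the terms of (8.22)). [folklore] -/
def FGYint (a k r0 r1 b k' : ℚ) (L s : ℝ) : ℂ :=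
  cexp ((((k : ℝ) * s * π : ℝ) : ℂ) * I) *
    (expQuadInt ((r0 : ℂ) * (1 + a * π * I * s)) ((r0 : ℂ) * a * π * I) 0 k L
      + expQuadInt ((1 + (a : ℂ) * π * I * s) * r1)
          (((1 + (a : ℂ) * π * I * s) * b + a * r1) * π * I) ((a : ℂ) * b * (π * I) ^ 2) (k - k') L)

/-- `∫₀ᴸ 𝔣𝔣_{a,k}(z+s)𝔤𝔥_{r₀,r₁,b,k'}(z) dz = FGYint …` for `k ≠ 0`, `k ≠ k'`. [folklore] -/
theorem integral_ffF_shift_mul_ghF (a k r0 r1 b k' : ℚ) (hk : k ≠ 0) (hkk : k - k' ≠ 0)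
    (L s : ℝ) :
    ∫ z in (0:ℝ)..L, ffF a k (z + s) * ghF r0 r1 b k' z = FGYint a k r0 r1 b k' L s := by
  rw [intervalIntegral.integral_congr (fun z _ => ffF_shift_mul_ghF a k r0 r1 b k' z s),
    intervalIntegral.integral_const_mul,
    intervalIntegral.integral_add (Continuous.intervalIntegrable (by fun_prop) _ _)
      (Continuous.intervalIntegrable (by fun_prop) _ _),
    integral_quad_mul_cexp _ _ _ hk, integral_quad_mul_cexp _ _ _ hkk]
  have eS : cexp ((k : ℂ) * π * I * (s : ℂ)) = cexp ((((k : ℝ) * s * π : ℝ) : ℂ) * I) := by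
    congr 1; push_cast; ring
  rw [eS]
  rfl

/-- Linearity for the three-term weighted integrands of (8.19)–(8.22). [folklore] -/
theorem integral_wsum3 {f g h : ℝ → ℂ} {w1 w2 w3 : ℂ} {A B : ℝ}
    (hf : Continuous f) (hg : Continuous g) (hh : Continuous h) :
    ∫ z in A..B, (w1 * f z + w2 * g z + w3 * h z)
      = w1 * (∫ z in A..B, f z) + w2 * (∫ z in A..B, g z) + w3 * (∫ z in A..B, h z) := by
  rw [intervalIntegral.integral_add (Continuous.intervalIntegrable (by fun_prop) _ _)
      (Continuous.intervalIntegrable (by fun_prop) _ _),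
    intervalIntegral.integral_add (Continuous.intervalIntegrable (by fun_prop) _ _)
      (Continuous.intervalIntegrable (by fun_prop) _ _),
    intervalIntegral.integral_const_mul, intervalIntegral.integral_const_mul,
    intervalIntegral.integral_const_mul]

/-- Closed form of `b₁₁` (note `0.504 = 63/125`, `1/0.504² = 15625/3969`). [folklore] -/
def b11val : ℂ :=
  ((((1/2 : ℚ) : ℂ) * FGint (1/2) (3/2) (8/3) (-5/3) (-1/2) ((63/125 : ℚ) : ℝ)
    + ((2 : ℚ) : ℂ) * FGint (-1/2) (3/2) (4/3) (-1/3) (1/2) ((63/125 : ℚ) : ℝ))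
    + ((3/2 : ℚ) : ℂ) * FGint (-3/2) (3/2) (8/9) (1/9) (1/6) ((63/125 : ℚ) : ℝ))
  * ((overPi (15625/3969) : ℝ) : ℂ)

/-- `b₁₁ = b11val`. [folklore] -/
theorem b11_eq : b11 = b11val := by
  have e1 := integral_ffF_mul_ghF (1/2) (3/2) (8/3) (-5/3) (-1/2) (by norm_num) (0.504 : ℝ)
  have e2 := integral_ffF_mul_ghF (-1/2) (3/2) (4/3) (-1/3) (1/2) (by norm_num) (0.504 : ℝ)
  have e3 := integral_ffF_mul_ghF (-3/2) (3/2) (8/9) (1/9) (1/6) (by norm_num) (0.504 : ℝ)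
  have hL : (0.504 : ℝ) = ((63/125 : ℚ) : ℝ) := by norm_num
  have hp : (1 / (0.504 ^ 2 * π) : ℝ) = overPi (15625/3969) := by
    unfold overPi; push_cast; field_simp; norm_num
  unfold b11 ff16 gh16 ff26 gh26 ff36 gh36
  rw [integral_wsum3, e1, e2, e3, hp, hL]
  · unfold b11val; push_cast; ring
  all_goals fun_prop

/-- Closed form of `b₂₂` (`1/0.5² = 4`). [folklore] -/
def b22val : ℂ :=
  ((((1/2 : ℚ) : ℂ) * FGint (3/2) (5/2) (24/25) (1/25) (1/10) ((1/2 : ℚ) : ℝ)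
    + ((2 : ℚ) : ℂ) * FGint (1/2) (5/2) (12/25) (13/25) (3/10) ((1/2 : ℚ) : ℝ))
    + ((3/2 : ℚ) : ℂ) * FGint (-1/2) (5/2) (8/25) (17/25) (-3/10) ((1/2 : ℚ) : ℝ))
  * ((overPi 4 : ℝ) : ℂ)

/-- `b₂₂ = b22val`. [folklore] -/
theorem b22_eq : b22 = b22val := by
  have e1 := integral_ffF_mul_ghF (3/2) (5/2) (24/25) (1/25) (1/10) (by norm_num) (0.5 : ℝ)
  have e2 := integral_ffF_mul_ghF (1/2) (5/2) (12/25) (13/25) (3/10) (by norm_num) (0.5 : ℝ)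
  have e3 := integral_ffF_mul_ghF (-1/2) (5/2) (8/25) (17/25) (-3/10) (by norm_num) (0.5 : ℝ)
  have hL : (0.5 : ℝ) = ((1/2 : ℚ) : ℝ) := by norm_num
  have hp : (1 / (0.5 ^ 2 * π) : ℝ) = overPi 4 := by
    unfold overPi; push_cast; field_simp; norm_num
  unfold b22 ff17 gh17 ff27 gh27 ff37 gh37
  rw [integral_wsum3, e1, e2, e3, hp, hL]
  · unfold b22val; push_cast; ring
  all_goals fun_prop

/-- Closed form of `b₂₁` (`1/((0.504)(0.5)) = 250/63`, `0.004 = 1/250`). [folklore] -/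
def b21val : ℂ :=
  ((((1/2 : ℚ) : ℂ) * FGXint (3/2) (5/2) (8/3) (-5/3) (-1/2) (3/2) ((1/2 : ℚ) : ℝ) ((1/250 : ℚ) : ℝ)
    + ((2 : ℚ) : ℂ)
      * FGXint (1/2) (5/2) (4/3) (-1/3) (1/2) (3/2) ((1/2 : ℚ) : ℝ) ((1/250 : ℚ) : ℝ))
    + ((3/2 : ℚ) : ℂ)
      * FGXint (-1/2) (5/2) (8/9) (1/9) (1/6) (3/2) ((1/2 : ℚ) : ℝ) ((1/250 : ℚ) : ℝ))
  * ((overPi (250/63) : ℝ) : ℂ)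

/-- `b₂₁ = b21val`. [folklore] -/
theorem b21_eq : b21 = b21val := by
  have e1 := integral_ffF_mul_ghF_shiftR (3/2) (5/2) (8/3) (-5/3) (-1/2) (3/2) (by norm_num)
    (by norm_num) (0.5 : ℝ) 0.004
  have e2 := integral_ffF_mul_ghF_shiftR (1/2) (5/2) (4/3) (-1/3) (1/2) (3/2) (by norm_num)
    (by norm_num) (0.5 : ℝ) 0.004
  have e3 := integral_ffF_mul_ghF_shiftR (-1/2) (5/2) (8/9) (1/9) (1/6) (3/2) (by norm_num)
    (by norm_num) (0.5 : ℝ) 0.004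
  have hL : (0.5 : ℝ) = ((1/2 : ℚ) : ℝ) := by norm_num
  have hs : (0.004 : ℝ) = ((1/250 : ℚ) : ℝ) := by norm_num
  have hp : (1 / (0.504 * 0.5 * π) : ℝ) = overPi (250/63) := by
    unfold overPi; push_cast; field_simp; norm_num
  unfold b21 ff17 gh16 ff27 gh26 ff37 gh36
  rw [integral_wsum3, e1, e2, e3, hp, hL, hs]
  · unfold b21val; push_cast; ring
  all_goals fun_prop

/-- Closed form of `b₁₂`. [folklore] -/
def b12val : ℂ :=
  ((((1/2 : ℚ) : ℂ)
      * FGYint (1/2) (3/2) (24/25) (1/25) (1/10) (5/2) ((1/2 : ℚ) : ℝ) ((1/250 : ℚ) : ℝ)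
    + ((2 : ℚ) : ℂ)
      * FGYint (-1/2) (3/2) (12/25) (13/25) (3/10) (5/2) ((1/2 : ℚ) : ℝ) ((1/250 : ℚ) : ℝ))
    + ((3/2 : ℚ) : ℂ)
      * FGYint (-3/2) (3/2) (8/25) (17/25) (-3/10) (5/2) ((1/2 : ℚ) : ℝ) ((1/250 : ℚ) : ℝ))
  * ((overPi (250/63) : ℝ) : ℂ)

/-- `b₁₂ = b12val`. [folklore] -/
theorem b12_eq : b12 = b12val := by
  have e1 := integral_ffF_shift_mul_ghF (1/2) (3/2) (24/25) (1/25) (1/10) (5/2) (by norm_num)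
    (by norm_num) (0.5 : ℝ) 0.004
  have e2 := integral_ffF_shift_mul_ghF (-1/2) (3/2) (12/25) (13/25) (3/10) (5/2) (by norm_num)
    (by norm_num) (0.5 : ℝ) 0.004
  have e3 := integral_ffF_shift_mul_ghF (-3/2) (3/2) (8/25) (17/25) (-3/10) (5/2) (by norm_num)
    (by norm_num) (0.5 : ℝ) 0.004
  have hL : (0.5 : ℝ) = ((1/2 : ℚ) : ℝ) := by norm_num
  have hs : (0.004 : ℝ) = ((1/250 : ℚ) : ℝ) := by norm_num
  have hp : (1 / (0.504 * 0.5 * π) : ℝ) = overPi (250/63) := by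
    unfold overPi; push_cast; field_simp; norm_num
  unfold b12 ff16 gh17 ff26 gh27 ff36 gh37
  rw [integral_wsum3, e1, e2, e3, hp, hL, hs]
  · unfold b12val; push_cast; ring
  all_goals fun_prop

end Literature.NumberTheory.LFunctions.Zhang2022
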